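import Summits.ABC.ABC.Theses.IneffectiveSubspace
import Summits.ABC.ABC.Theorems.IneffectiveSubspaceUniformSadicTowerFourQuarticRootWall
import Summits.ABC.ABC.Theorems.IneffectiveSubspaceUniformSadicTowerFourGaussianNormalForm

/-!
# The `ℤ[i]` reading of the Pell-square cell: uniform harmonic quartic Thue bound (stmt-ABC-14937)

Second calibration file of line `SketchIdeator4` (card
`Cruxes/UniformSadicTowerFour/Ideas/gaussian-thue-pell-square.md` §Lever, notes `BarrierNotes-r2-k4.md`
N1) for crux #2 `UniformSadicTowerFour` of route `IneffectiveSubspace`.  The cell `1 + t² = m·n⁴` of the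
`K = 0` face lives in `ℤ[i]`: `t² + 1 = N(t + i)`.  Contents:

* `im_pow_four_mul`, `re_pow_four_mul` — for `ν = e + fi`, `μ = C + Di`:
  `Im(ν⁴·μ) = D e⁴ + 4C e³f − 6D e²f² − 4C ef³ + D f⁴` (the HARMONIC binary quartics, `J = 0`;
  `= D·P_s(e,f)` with `P_s` the simplest quartic form) and the companion real part.
* `natAbs_re_sq_add_one_of_im_eq` — a solution of the Thue equation `Im(μ·ν⁴) = ±1` is a cell point:
  `|Re(μν⁴)|² + 1 = N(μ)·N(ν)⁴`.
* `uniformHarmonicThue_of_pellSquareCell` — hence `PellSquareCell` (inlined: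
  `1 + t² = m·n⁴ ⟹ n ≤ C_ε·m^(1/2+ε)`) is a UNIFORM THUE BOUND: every solution of `Im(μ·ν⁴) = ±1`
  has `N(ν) ≤ max C_ε 1 · N(μ)^(1/2+ε)`, i.e. `e² + f² ≤ C·(C² + D²)^(1/2+ε)`, polynomial in the height
  of the form and uniform over the two-parameter family; `uniformHarmonicThue_of_uniformSadicTowerFour`
  — **the crux implies it** (through the landed `QuarticRootWall.pellSquareCell_of_uniformSadicTowerFour`).
  The settled slice `D = ±1` of this family is Lettl–Pethő 1995 / Chen–Voutier 1997 (card §Why it bites).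
* `pellSquareCell_of_uniformHarmonicThue` — the converse, through the landed `ℤ[i]` normal form
  `GaussianNormalForm.thueSolution_of_cell` (`t + i = μ·ν⁴`): so on the cell the crux, `W₄`,
  `PellSquareCell` and the uniform harmonic Thue bound are four readings of ONE statement.
* small print of the wall `W₄`: `sq_le_of_pow_four_dvd` (trivial exponent: `n⁴ ∣ t² + 1 ⟹ n² ≤ t`),
  `odd_of_pow_four_dvd` (the modulus is odd), `ljunggren_point` (`239² + 1 = 2·13⁴`, the census enemy
  `log 239 / log 13 = 2.135`) and `ljunggren_gaussian` (`(3+2i)⁴(1+i) = −239 + i`, the solution `(3,2)`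
  of the `s = 4` simplest-quartic Thue equation).

What is NOT here: no composition concluding the crux — every statement in this file is a consequence
or a reformulation of the `K = 0` face on one cell (see `Lines/SketchIdeator4.dead.md` in the crux directory).
-/

-- `Summit.<Summit>.<Problem>` is the mandated summit-side namespace (CONVENTIONS §2); for the
-- single-conjunct summit `ABC` the two coincide, so the duplicate `ABC.ABC` is deliberate.
set_option linter.dupNamespace false

namespace Summit.ABC.ABC.Theorems.UniformSadicTowerFour.QuarticRootWall

open scoped BigOperators
open Summit.ABC.ABC.Theses.IneffectiveSubspace
open Summit.ABC.ABC.Theorems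

/-! ## The `ℤ[i]` reading: uniform bound for the harmonic quartic Thue equations -/

/-- **The harmonic quartic form.** For `ν = e + fi`, `μ = C + Di` in `ℤ[i]`:
`Im(ν⁴·μ) = D e⁴ + 4C e³f − 6D e²f² − 4C ef³ + D f⁴` — the integral binary quartics with invariant
`J = 0` (`= D·P_s(e,f)`, `P_s` the simplest quartic form, `s = −4C/D`). (Card: `im_pow_four_mul`.)
[folklore] -/
theorem im_pow_four_mul (e f C D : ℤ) :
    ((⟨e, f⟩ : GaussianInt) ^ 4 * (⟨C, D⟩ : GaussianInt)).im =
      D * e ^ 4 + 4 * C * e ^ 3 * f - 6 * D * e ^ 2 * f ^ 2 - 4 * C * e * f ^ 3 + D * f ^ 4 := by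
  simp only [pow_succ, pow_zero, one_mul, Zsqrtd.im_mul, Zsqrtd.re_mul]
  ring

/-- Companion of `im_pow_four_mul`: `Re(ν⁴·μ) = C e⁴ − 4D e³f − 6C e²f² + 4D ef³ + C f⁴`. [folklore] -/
theorem re_pow_four_mul (e f C D : ℤ) :
    ((⟨e, f⟩ : GaussianInt) ^ 4 * (⟨C, D⟩ : GaussianInt)).re =
      C * e ^ 4 - 4 * D * e ^ 3 * f - 6 * C * e ^ 2 * f ^ 2 + 4 * D * e * f ^ 3 + C * f ^ 4 := by
  simp only [pow_succ, pow_zero, one_mul, Zsqrtd.im_mul, Zsqrtd.re_mul]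
  ring

/-- **Thue solutions are cell points.** If `Im(μ·ν⁴) = ±1` in `ℤ[i]` then, with `t := |Re(μ·ν⁴)|`,
`t² + 1 = N(μ)·N(ν)⁴` (multiplicativity of the norm). [folklore] -/
theorem natAbs_re_sq_add_one_of_im_eq (μ ν : GaussianInt) (h : (μ * ν ^ 4).im = 1 ∨ (μ * ν ^ 4).im = -1) :
    ((μ * ν ^ 4).re.natAbs : ℤ) ^ 2 + 1 = μ.norm * ν.norm ^ 4 := by
  have hn : (μ * ν ^ 4).norm = μ.norm * ν.norm ^ 4 := by
    simp only [pow_succ, pow_zero, one_mul, Zsqrtd.norm_mul]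
  rw [← hn, Zsqrtd.norm_def, Int.natAbs_sq]
  rcases h with h | h <;> rw [h] <;> ring

/-- **`PellSquareCell` is a uniform Thue bound.** If `1 + t² = m·n⁴ ⟹ n ≤ C_ε·m^(1/2+ε)`, then every
solution of a harmonic quartic Thue equation `Im(μ·ν⁴) = ±1` (`μ, ν ∈ ℤ[i]`, i.e.
`D e⁴ + 4C e³f − 6D e²f² − 4C ef³ + D f⁴ = ±1` by `im_pow_four_mul`) satisfies
`N(ν) ≤ max C_ε 1 · N(μ)^(1/2+ε)` — a bound polynomial in the height of the form, UNIFORM over the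
two-parameter family (card §Lever; the settled `D = ±1` slice is Lettl–Pethő 1995 / Chen–Voutier 1997).
[folklore] -/
theorem uniformHarmonicThue_of_pellSquareCell
    (hP : ∀ ε : ℝ, 0 < ε → ∃ C : ℝ, 0 < C ∧ ∀ t m n : ℕ, 0 < t → 0 < m → 0 < n →
      1 + t ^ 2 = m * n ^ 4 → (n : ℝ) ≤ C * (m : ℝ) ^ ((1 : ℝ) / 2 + ε)) :
    ∀ ε : ℝ, 0 < ε → ∃ C : ℝ, 0 < C ∧ ∀ μ ν : GaussianInt,
      ((μ * ν ^ 4).im = 1 ∨ (μ * ν ^ 4).im = -1) →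
      (ν.norm : ℝ) ≤ C * (μ.norm : ℝ) ^ ((1 : ℝ) / 2 + ε) := by
  intro ε hε
  obtain ⟨C, hC, hCP⟩ := hP ε hε
  refine ⟨max C 1, by positivity, fun μ ν h => ?_⟩
  have hcellZ := natAbs_re_sq_add_one_of_im_eq μ ν h
  -- the natural numbers `t, m, n`
  set t : ℕ := (μ * ν ^ 4).re.natAbs with htdef
  have hμ0 : 0 ≤ μ.norm := GaussianInt.norm_nonneg μ
  have hν0 : 0 ≤ ν.norm := GaussianInt.norm_nonneg ν
  obtain ⟨m, hm⟩ := Int.eq_ofNat_of_zero_le hμ0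
  obtain ⟨n, hn⟩ := Int.eq_ofNat_of_zero_le hν0
  rw [hm, hn] at hcellZ
  have hcell : 1 + t ^ 2 = m * n ^ 4 := by
    have : ((1 + t ^ 2 : ℕ) : ℤ) = ((m * n ^ 4 : ℕ) : ℤ) := by push_cast; linarith
    exact_mod_cast this
  have hm0 : 0 < m := by
    rcases Nat.eq_zero_or_pos m with rfl | h'
    · simp at hcell
    · exact h'
  have hn0 : 0 < n := by
    rcases Nat.eq_zero_or_pos n with rfl | h'
    · simp at hcell
    · exact h'
  have hM1 : (1 : ℝ) ≤ m := by exact_mod_cast hm0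
  have hcastμ : (μ.norm : ℝ) = m := by rw [hm]; rfl
  have hcastν : (ν.norm : ℝ) = n := by rw [hn]; rfl
  rw [hcastμ, hcastν]
  rcases Nat.eq_zero_or_pos t with ht | ht
  · -- `t = 0`: `1 = m n⁴`, so `n = 1`
    rw [ht] at hcell
    have hn1 : n = 1 := by
      have h1 : m * n ^ 4 = 1 := by omega
      have := Nat.eq_one_of_mul_eq_one_left h1
      exact (Nat.pow_eq_one.mp this).resolve_right (by norm_num)
    subst hn1
    calc ((1 : ℕ) : ℝ) = 1 * 1 := by simp
      _ ≤ max C 1 * (m : ℝ) ^ ((1 : ℝ) / 2 + ε) :=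
        mul_le_mul (le_max_right _ _) (Real.one_le_rpow hM1 (by positivity)) zero_le_one
          (by positivity)
  · calc (n : ℝ) ≤ C * (m : ℝ) ^ ((1 : ℝ) / 2 + ε) := hCP t m n ht hm0 hn0 hcell
      _ ≤ max C 1 * (m : ℝ) ^ ((1 : ℝ) / 2 + ε) := by gcongr; exact le_max_left _ _

/-- **The crux implies a uniform polynomial bound for the harmonic quartic Thue equations**
`Im(μ·ν⁴) = ±1` in `ℤ[i]`: `N(ν) ≤ C_ε·N(μ)^(1/2+ε)`, i.e. `e² + f² ≤ C_ε·(C² + D²)^(1/2+ε)` for every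
solution of `D e⁴ + 4C e³f − 6D e²f² − 4C ef³ + D f⁴ = ±1`. [folklore] -/
theorem uniformHarmonicThue_of_uniformSadicTowerFour (hU : UniformSadicTowerFour) :
    ∀ ε : ℝ, 0 < ε → ∃ C : ℝ, 0 < C ∧ ∀ μ ν : GaussianInt,
      ((μ * ν ^ 4).im = 1 ∨ (μ * ν ^ 4).im = -1) →
      (ν.norm : ℝ) ≤ C * (μ.norm : ℝ) ^ ((1 : ℝ) / 2 + ε) :=
  uniformHarmonicThue_of_pellSquareCell (pellSquareCell_of_uniformSadicTowerFour hU)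

/-- **The converse: a uniform harmonic Thue bound gives `PellSquareCell`.** If every solution of
`Im(μ·ν⁴) = ±1` has `N(ν) ≤ C_ε·N(μ)^(1/2+ε)`, then `1 + t² = m·n⁴ ⟹ n ≤ C_ε·m^(1/2+ε)`: by the
`ℤ[i]` normal form (`GaussianNormalForm.thueSolution_of_cell`) a cell point IS such a solution with
`N(μ) = m`, `N(ν) = n`. [folklore] -/
theorem pellSquareCell_of_uniformHarmonicThue
    (hT : ∀ ε : ℝ, 0 < ε → ∃ C : ℝ, 0 < C ∧ ∀ μ ν : GaussianInt,
      ((μ * ν ^ 4).im = 1 ∨ (μ * ν ^ 4).im = -1) →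
      (ν.norm : ℝ) ≤ C * (μ.norm : ℝ) ^ ((1 : ℝ) / 2 + ε)) :
    ∀ ε : ℝ, 0 < ε → ∃ C : ℝ, 0 < C ∧ ∀ t m n : ℕ, 0 < t → 0 < m → 0 < n →
      1 + t ^ 2 = m * n ^ 4 → (n : ℝ) ≤ C * (m : ℝ) ^ ((1 : ℝ) / 2 + ε) := by
  intro ε hε
  obtain ⟨C, hC, hCT⟩ := hT ε hε
  refine ⟨C, hC, fun t m n _ _ _ hcell => ?_⟩
  obtain ⟨μ, ν, hμ, hν, him, -⟩ := GaussianNormalForm.thueSolution_of_cell hcell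
  have key := hCT μ ν (Or.inl him)
  rw [hμ, hν] at key
  exact_mod_cast key

/-! ## Small print of the wall -/

/-- **The trivial exponent (`λ ≥ 2`).** If `t > 0` and `n⁴ ∣ t² + 1` then `n² ≤ t`
(`n⁴ ≤ t² + 1 < (t+1)²`). [folklore] -/
theorem sq_le_of_pow_four_dvd {t n : ℕ} (ht : 0 < t) (h : n ^ 4 ∣ t ^ 2 + 1) : n ^ 2 ≤ t := by
  have hle : n ^ 4 ≤ t ^ 2 + 1 := Nat.le_of_dvd (Nat.succ_pos _) h
  by_contra hcon
  push Not at hcon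
  have : (t + 1) ^ 2 ≤ (n ^ 2) ^ 2 := Nat.pow_le_pow_left hcon 2
  nlinarith

/-- **The modulus is odd.** If `n⁴ ∣ t² + 1` then `n` is odd (`4 ∤ t² + 1`). [folklore] -/
theorem odd_of_pow_four_dvd {t n : ℕ} (h : n ^ 4 ∣ t ^ 2 + 1) : Odd n := by
  obtain ⟨m, hm⟩ := h
  have hcell : 1 + t ^ 2 = m * n ^ 4 := by rw [add_comm, hm]; ring
  exact Nat.odd_iff.mpr (Nat.two_dvd_ne_zero.mp (GaussianNormalForm.not_two_dvd_of_cell hcell))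

/-- **Ljunggren's point** `239² + 1 = 2·13⁴`: the cell's record enemy (`t = 239`, `m = 2`, `n = 13`;
`log 239 / log 13 = 2.135…`, abc quality `1.254` of `(1, 239², 2·13⁴)`). [folklore] -/
theorem ljunggren_point : 1 + 239 ^ 2 = 2 * 13 ^ 4 := by norm_num

/-- … and its `ℤ[i]` normal form `(3 + 2i)⁴·(1 + i) = −239 + i` (`N(3+2i) = 13`, `N(1+i) = 2`): the
solution `(e,f) = (3,2)` of the `s = 4` simplest-quartic Thue equation (card §Why it bites (a)).
[folklore] -/
theorem ljunggren_gaussian : (⟨3, 2⟩ : GaussianInt) ^ 4 * ⟨1, 1⟩ = ⟨-239, 1⟩ := by decide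

end Summit.ABC.ABC.Theorems.UniformSadicTowerFour.QuarticRootWall
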